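import Literature.MathematicalPhysics.QuantumLattice.GrassmannTruncatedMoments
import Literature.Probability.LatticeModels.CumulantExponentialClosedForm
import HarnessLib

/-!
# `∫P(dψ) e^{tX} = exp Σₙ tⁿ 𝓔ᵀ(X; n)/n!` for the Gaussian Grassmann integration

Topic `Literature/MathematicalPhysics/QuantumLattice`; the Grassmann instance of the closed-form
exponential formula (`CumulantExponentialClosedForm.lean`): for the normalised moments
`𝓔(Xᵏ)` (`gaussMoment`) of an element `X` under the Gaussian integration of a fermion block and its
truncated expectations `𝓔ᵀ(X; k)` (`gaussTruncated`), the exponential generating functions satisfy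

`Σₖ 𝓔(Xᵏ) tᵏ/k! = exp (Σ_{k ≥ 1} 𝓔ᵀ(X; k) tᵏ/k!)`   (`egf_gaussMoment_eq_exp_subst`)

in `R⟦t⟧` — the formula `∫P(dψ) e^{X} = exp Σₙ 𝓔ᵀ(X; n)/n!` by which the effective potential on
the next scale is *defined* in multiscale analysis (Mastropietro 2008, (2.36), (2.47)–(2.53);
Benfatto–Giuliani–Mastropietro 2006, (2.13), (2.29)–(2.31):
`𝒱^{(h-1)} + L²βẽ_h = Σₙ (1/n!) (-1)^{n+1} 𝓔ᵀ_h(-𝒱̂^{(h)}; n)`), stated as an identity of formal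
power series in the counting variable.  Everything is proved; no named fact.

## Sources

V. Mastropietro, *Non-Perturbative Renormalization* (2008), §2.3 (2.35)–(2.36), §2.5 (2.47)–(2.53)
(`Mastropietro2008`); G. Benfatto, A. Giuliani, V. Mastropietro, Ann. Henri Poincaré 7 (2006),
(2.13)–(2.14), (2.29)–(2.31) (`BenfattoGiulianiMastropietro2006`).
-/

noncomputable section

namespace Literature.MathematicalPhysics.QuantumLattice

open PowerSeries Literature.Probability.LatticeModels

variable (R : Type*) [CommRing R] [Algebra ℚ R] {ι : Type*} [LinearOrder ι] [Fintype ι]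
  {J : Type*} [LinearOrder J] [Fintype J]
variable (e : ι ⊕ₗ ι ↪o J) (A : Matrix ι ι R) (u : R) (X : GrassmannAlgebra R J)

/-- **`∫P(dψ) e^{tX} = exp Σₙ tⁿ 𝓔ᵀ(X; n)/n!`** for the normalised Gaussian Grassmann integration of
a block (`u · ε det A = 1` the normalisation): the exponential generating function of the moments
`𝓔(Xᵏ)` is the exponential of that of the truncated expectations `𝓔ᵀ(X; k)`, as formal power
series (Mastropietro 2008, (2.36); Benfatto–Giuliani–Mastropietro 2006, (2.13), (2.31)). [cite: Mastropietro2008, §2.3 (2.35)-(2.36)] -/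
theorem egf_gaussMoment_eq_exp_subst
    (hu : u * ((-1 : R) ^ (Fintype.card ι * (Fintype.card ι - 1) / 2) * A.det) = 1) :
    egf (gaussMoment R e A u X) = (exp R).subst (egfPos (gaussTruncated R e A u X)) :=
  egf_eq_exp_subst_egfPos_cumulantOf _ (gaussMoment_zero R e A u X hu)

end Literature.MathematicalPhysics.QuantumLattice
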